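import Literature.Combinatorics.Additive.SpreadCouplingTuples
import HarnessLib

/-!
# The forgetful coupling of `S_n` with `[n]^n` and the junta lower bound (Keevash–Lifshitz 2023, §2.1, §2.4, Lemma 2.9)

Source: P. Keevash, N. Lifshitz, *Sharp hypercontractivity for symmetric groups and its applications*,
arXiv:2307.15030 [KeevashLifshitz2023], §2.1 "Coupling" (Def. 2.1 greedy coupling, Def. 2.2 forgetful
model, Lemma 2.3, Lemma 2.4), §2.3 (Lemma 2.9), §2.4 (eq. (fg), eq. (lazy), "clearly `ν` is
`10/n`-spread"); held text `paper:arxiv-2307.15030` pp. 12–14 read first-hand (cell pnp-psdrank, lit g20,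
2026-08-27).

Third brick of the programme (cell memo LIT-26, Milestone M) to prove the `S_n` layer of
Keevash–Lifshitz Thm 3.1 ⇒ 1.8. Everything in COUNTING normalisation (explicit `n!`, `n^n`):

* `cw σ i y` — the one-step law of the FORGETFUL MODEL (Def. 2.2, coordinates `0,…,n−1`): given
  `σ`, coordinate `i` of `x` is `σ i` ("remembered") with probability `(n−i)/n`, and each earlier value
  `σ j`, `j < i`, with probability `1/n`; `coupling σ x = (1/n!) Π_i cw σ i (x i)` is the joint law
  `C(σ, x)` on `S_n × [n]^n`. PROVED: `C ≥ 0`; the `σ`-marginal is uniform (`sum_coupling_right`: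
  `Σ_x C(σ,x) = 1/n!`); the `x`-MARGINAL IS UNIFORM (`sum_coupling_left`: `Σ_σ C(σ,x) = 1/n^n` — the
  content of Lemma 2.3, proved by the prefix induction `Σ_σ F(σ|_{<k}) cw σ k y = (1/n) Σ_σ F`, averaging
  over the pointwise stabiliser of `{0,…,k−1}`); LEFT INVARIANCE `C(τσ, τ∘x) = C(σ,x)` (Lemma 2.4).
* the INDUCED KERNEL on `d`-tuples at injective positions `ι : Fin d ↪ Fin n` (§2.4):
  `indKernel ι a b = C(σ∘ι = a, x∘ι = b) = (1/n!) Σ_{σ : σ∘ι = a} Π_k cw σ (ι k) (b k)` (the free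
  coordinates integrate out, `sum_constrained_prod`); PROVED: nonnegative, left-invariant
  (`Tuple.IsLeftInvariant`), POINTWISE `2/n`-SPREAD (`Tuple.IsSpread … (2/n)`) as soon as every
  position satisfies `2·ι k ≤ n` (then the lazy weight `(n − ι k)/n ≥ 1/2` dominates `2/n · ` the moving
  weight `1/n`) — the paper's "clearly `ν` is `10/n`-spread" —, diagonal mass
  `Σ_a ν(a,a) = Π_k (n − ι k)/n ≥ 2^{−d}` (eq. (lazy)), and eq. (fg):
  `Σ_{σ,x} C(σ,x) f(σ) f̃(x) = Σ_{a,b} ν(a,b) g(a) g(b)` for `f = g(σ∘ι)` and its associated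
  `[n]^n`-junta `f̃(x) = g(x∘ι)·1[x∘ι injective]`.
* **Lemma 2.9 (counting form)** `junta_coupling_lower_bound`: for `g` of pure top degree on
  `[n]_d` (`Tuple.IsPureTop`), positions with `2·ι k ≤ n`, and `16 d ≤ n`,
  `Σ_{σ,x} C(σ,x) f(σ) f̃(x) ≥ 2^{−(d+1)} · (1/n!) Σ_σ f(σ)²`, i.e. `⟨T_C f, f̃⟩ ≥ 2^{−(d+1)} ‖f‖₂²` in
  the paper's normalisation (print: `3^{−d}`; any `c^{−d}` serves Theorem 3.1), from brick
  `SpreadCouplingTuples` (`quadratic_form_ge`, `patExtSum_le_of_le`).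

DEVIATIONS FROM PRINT (declared): (1) the coupling is DEFINED by the forgetful model's closed form and
the uniformity of the `x`-marginal is proved directly (the paper defines the greedy coupling, Def. 2.1,
and proves equivalence, Lemma 2.3; the greedy description is not needed downstream and not formalised);
(2) spreadness is proved in the pointwise form with `p = 2/n` using only `ι k ≤ n/2` (the paper asks
`I ⊆ [n/4, n/2]` and states `10/n`); (3) the constant `2^{−(d+1)}` in Lemma 2.9 (print `3^{−d}`), via the
sharper `SpreadCouplingTuples.quadratic_form_ge`. The hypothesis that `f` is a `T`-junta of pure degree
`d` on `S_n` enters here only through `g` (pure top on tuples); the translation from the tree's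
`degLE`/`levelPart` on `SnSpace n` is the assembly brick's business.

NOT here: `T_C`, `T_C^*` as operators, (bi)globalness preservation (Lemmas 2.6/2.7 — with the `[n]^n`
vocabulary, next brick), the noise operator, §3. No facts, no instances, no notation; standard axioms.
WHAT THIS IS NOT: not a proof of Theorem 1.8/3.1; nothing about matchings or psd rank; no P-vs-NP content.
-/

noncomputable section

namespace Literature.Combinatorics.Additive.KeevashLifshitz

namespace Coupling

open Finset

variable {n : ℕ}

/-! ## The forgetful model -/

/-- One step of the **forgetful model** (KL Def. 2.2, coordinates indexed `0,…,n−1`): given `σ`, the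
law of the `i`-th coordinate of `x` — the value `σ i` with probability `(n − i)/n`, each earlier value
`σ j` (`j < i`) with probability `1/n`, nothing else. [cite: KeevashLifshitz2023, Def. 2.2] -/
def cw (σ : Equiv.Perm (Fin n)) (i y : Fin n) : ℝ :=
  if y = σ i then ((n : ℝ) - i) / n else if ∃ j : Fin n, j < i ∧ σ j = y then 1 / n else 0

/-- [cite: KeevashLifshitz2023, Def. 2.2] -/
theorem cw_self (σ : Equiv.Perm (Fin n)) (i : Fin n) : cw σ i (σ i) = ((n : ℝ) - i) / n := by
  simp [cw]

/-- [cite: KeevashLifshitz2023, Def. 2.2] -/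
theorem cw_nonneg (σ : Equiv.Perm (Fin n)) (i y : Fin n) : 0 ≤ cw σ i y := by
  unfold cw
  have hi : (i : ℝ) < n := by exact_mod_cast i.isLt
  split_ifs
  · exact div_nonneg (by linarith) (by positivity)
  · positivity
  · exact le_rfl

/-- A non-remembered value has weight `≤ 1/n`. [cite: KeevashLifshitz2023, Def. 2.2] -/
theorem cw_le_of_ne {σ : Equiv.Perm (Fin n)} {i y : Fin n} (h : y ≠ σ i) : cw σ i y ≤ 1 / n := by
  unfold cw
  rw [if_neg h]
  split_ifs
  · exact le_rfl
  · positivity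

/-- The remembered value has weight `≥ 1/2` at positions `i ≤ n/2`. [cite: KeevashLifshitz2023, §2.4 (eq. (lazy))] -/
theorem half_le_cw_self (σ : Equiv.Perm (Fin n)) {i : Fin n} (hi : 2 * (i : ℕ) ≤ n) :
    1 / 2 ≤ cw σ i (σ i) := by
  rw [cw_self]
  have hn : (0 : ℝ) < n := by exact_mod_cast i.pos
  have : (2 : ℝ) * (i : ℕ) ≤ n := by exact_mod_cast hi
  rw [div_le_div_iff₀ (by norm_num) hn]
  linarith

/-- **The forgetful one-step law is a probability vector**: `Σ_y cw σ i y = 1`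
(`(n−i)/n + i·(1/n)`). [cite: KeevashLifshitz2023, Def. 2.2 ("to make the marginal distribution of `x` uniform")] -/
theorem sum_cw (σ : Equiv.Perm (Fin n)) (i : Fin n) : ∑ y, cw σ i y = 1 := by
  classical
  have hn : (0 : ℝ) < n := by exact_mod_cast i.pos
  -- split off the remembered value
  rw [← add_sum_erase _ _ (mem_univ (σ i)), cw_self]
  have hrest : ∑ y ∈ univ.erase (σ i), cw σ i y =
      ∑ y ∈ univ.erase (σ i), if ∃ j : Fin n, j < i ∧ σ j = y then (1 : ℝ) / n else 0 := by
    refine sum_congr rfl fun y hy => ?_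
    rw [cw, if_neg (ne_of_mem_erase hy)]
  rw [hrest, sum_ite, sum_const_zero, add_zero, sum_const, nsmul_eq_mul]
  -- the earlier values `σ j`, `j < i`, are `i` many
  have hcard : ((univ.erase (σ i)).filter (fun y => ∃ j : Fin n, j < i ∧ σ j = y)).card = i := by
    rw [show (univ.erase (σ i)).filter (fun y => ∃ j : Fin n, j < i ∧ σ j = y) =
        (Finset.Iio i).image σ from ?_]
    · rw [card_image_of_injective _ σ.injective, Fin.card_Iio]
    · ext y
      rw [mem_filter, mem_erase, mem_image]
      constructor
      · rintro ⟨-, j, hj, rfl⟩; exact ⟨j, Finset.mem_Iio.2 hj, rfl⟩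
      · rintro ⟨j, hj, rfl⟩
        rw [Finset.mem_Iio] at hj
        refine ⟨⟨fun e => ?_, mem_univ _⟩, j, hj, rfl⟩
        rw [σ.injective e] at hj
        exact lt_irrefl _ hj
  rw [hcard]
  field_simp
  ring

/-- **Left invariance of the one-step law**: renaming the values does not change the weights.
[cite: KeevashLifshitz2023, Lemma 2.4] -/
theorem cw_lmul (τ σ : Equiv.Perm (Fin n)) (i y : Fin n) : cw (τ * σ) i (τ y) = cw σ i y := by
  unfold cw
  simp only [Equiv.Perm.mul_apply, τ.injective.eq_iff]

/-- The one-step law at coordinate `i` depends on `σ` only through `σ 0, …, σ i`.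
[cite: KeevashLifshitz2023, Def. 2.2] -/
theorem cw_mul_of_fix (σ π : Equiv.Perm (Fin n)) {i : Fin n} (hπ : ∀ j : Fin n, j ≤ i → π j = j)
    (y : Fin n) : cw (σ * π) i y = cw σ i y := by
  unfold cw
  have h1 : (σ * π) i = σ i := by rw [Equiv.Perm.mul_apply, hπ i le_rfl]
  have h2 : (∃ j : Fin n, j < i ∧ (σ * π) j = y) ↔ ∃ j : Fin n, j < i ∧ σ j = y := by
    constructor
    · rintro ⟨j, hj, e⟩; exact ⟨j, hj, by rwa [Equiv.Perm.mul_apply, hπ j hj.le] at e⟩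
    · rintro ⟨j, hj, e⟩; exact ⟨j, hj, by rw [Equiv.Perm.mul_apply, hπ j hj.le]; exact e⟩
  rw [h1]
  simp only [h2]

/-- **The coupling** `C(σ, x) = (1/n!) Π_i cw σ i (x i)` on `S_n × [n]^n` (the forgetful model run from
a uniform `σ`). [cite: KeevashLifshitz2023, Def. 2.2 and Lemma 2.3] -/
def coupling (σ : Equiv.Perm (Fin n)) (x : Fin n → Fin n) : ℝ :=
  ((n.factorial : ℝ))⁻¹ * ∏ i, cw σ i (x i)

/-- [cite: KeevashLifshitz2023, Def. 2.2] -/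
theorem coupling_nonneg (σ : Equiv.Perm (Fin n)) (x : Fin n → Fin n) : 0 ≤ coupling σ x :=
  mul_nonneg (by positivity) (prod_nonneg fun i _ => cw_nonneg σ i (x i))

/-- **The `σ`-marginal is uniform**: `Σ_x C(σ, x) = 1/n!`. [cite: KeevashLifshitz2023, Def. 2.2 (`σ ∼ S_n` uniform)] -/
theorem sum_coupling_right (σ : Equiv.Perm (Fin n)) : ∑ x : Fin n → Fin n, coupling σ x = ((n.factorial : ℝ))⁻¹ := by
  classical
  unfold coupling
  rw [← mul_sum]
  have : ∑ x : Fin n → Fin n, ∏ i, cw σ i (x i) = ∏ i : Fin n, ∑ y : Fin n, cw σ i y := by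
    rw [prod_univ_sum]
    simp only [Fintype.piFinset_univ]
  rw [this, prod_eq_one fun i _ => sum_cw σ i, mul_one]

/-- **Left invariance of the coupling** (KL Lemma 2.4): `C(τσ, τ∘x) = C(σ, x)`.
[cite: KeevashLifshitz2023, Lemma 2.4] -/
theorem coupling_lmul (τ σ : Equiv.Perm (Fin n)) (x : Fin n → Fin n) :
    coupling (τ * σ) (τ ∘ x) = coupling σ x := by
  unfold coupling
  simp only [Function.comp_apply, cw_lmul]

/-! ## The `x`-marginal is uniform (KL Lemma 2.3) -/

/-- The pointwise stabiliser of the positions `< k`. [cite: KeevashLifshitz2023, Lemma 2.3 (proof: "the conflicting set `C_i`")] -/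
def stabLT (n k : ℕ) : Finset (Equiv.Perm (Fin n)) := univ.filter fun π => ∀ j : Fin n, (j : ℕ) < k → π j = j

/-- [cite: KeevashLifshitz2023, Lemma 2.3] -/
theorem mem_stabLT {k : ℕ} {π : Equiv.Perm (Fin n)} : π ∈ stabLT n k ↔ ∀ j : Fin n, (j : ℕ) < k → π j = j := by
  simp [stabLT]

/-- [cite: KeevashLifshitz2023, Lemma 2.3] -/
theorem one_mem_stabLT (k : ℕ) : (1 : Equiv.Perm (Fin n)) ∈ stabLT n k :=
  mem_stabLT.2 fun _ _ => rfl

/-- [cite: KeevashLifshitz2023, Lemma 2.3] -/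
theorem mul_mem_stabLT {k : ℕ} {π π' : Equiv.Perm (Fin n)} (h : π ∈ stabLT n k) (h' : π' ∈ stabLT n k) :
    π * π' ∈ stabLT n k :=
  mem_stabLT.2 fun j hj => by rw [Equiv.Perm.mul_apply, mem_stabLT.1 h' j hj, mem_stabLT.1 h j hj]

/-- [cite: KeevashLifshitz2023, Lemma 2.3] -/
theorem inv_mem_stabLT {k : ℕ} {π : Equiv.Perm (Fin n)} (h : π ∈ stabLT n k) : π⁻¹ ∈ stabLT n k :=
  mem_stabLT.2 fun j hj => by
    have := mem_stabLT.1 h j hj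
    conv_lhs => rw [← this]
    simp

/-- A permutation fixing the positions `< k` maps position `k` to a position `≥ k`.
[cite: KeevashLifshitz2023, Lemma 2.3] -/
theorem le_apply_of_mem_stabLT {k : Fin n} {π : Equiv.Perm (Fin n)} (h : π ∈ stabLT n k) : k ≤ π k := by
  by_contra hlt
  have hlt : π k < k := not_le.1 hlt
  have := mem_stabLT.1 h (π k) hlt
  exact (lt_irrefl k) (by have e := π.injective this; rw [e] at hlt; exact hlt)

/-- The one-step law at position `k` after right multiplication by a permutation fixing the positions
`< k`. [cite: KeevashLifshitz2023, Lemma 2.3 (proof)] -/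
theorem cw_mul_stab (σ : Equiv.Perm (Fin n)) {k : Fin n} {π : Equiv.Perm (Fin n)} (hπ : π ∈ stabLT n k)
    (y : Fin n) :
    cw (σ * π) k y = if y = σ (π k) then ((n : ℝ) - k) / n
      else if ∃ j : Fin n, j < k ∧ σ j = y then 1 / n else 0 := by
  unfold cw
  have h2 : (∃ j : Fin n, j < k ∧ σ (π j) = y) ↔ ∃ j : Fin n, j < k ∧ σ j = y := by
    constructor
    · rintro ⟨j, hj, e⟩
      exact ⟨j, hj, by rwa [mem_stabLT.1 hπ j hj] at e⟩
    · rintro ⟨j, hj, e⟩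
      exact ⟨j, hj, by rw [mem_stabLT.1 hπ j hj]; exact e⟩
  simp only [Equiv.Perm.mul_apply, h2]

/-- All fibres `{π ∈ Stab_{<k} : π k = v}`, `v ≥ k`, have the same size (transposition bijection).
[cite: KeevashLifshitz2023, Lemma 2.3 (proof: "by symmetry the marginal distribution of `σ(i)` is uniform in `[n] ∖ C_i`")] -/
theorem card_stabLT_fibre_eq {k v v' : Fin n} (hv : k ≤ v) (hv' : k ≤ v') :
    ((stabLT n k).filter (fun π => π k = v)).card = ((stabLT n k).filter (fun π => π k = v')).card := by
  classical
  refine card_nbij' (fun π => Equiv.swap v v' * π) (fun π => Equiv.swap v v' * π) ?_ ?_ ?_ ?_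
  · intro π hπ
    rw [mem_coe, mem_filter] at hπ ⊢
    refine ⟨mem_stabLT.2 fun j hj => ?_, ?_⟩
    · rw [Equiv.Perm.mul_apply, mem_stabLT.1 hπ.1 j hj]
      exact Equiv.swap_apply_of_ne_of_ne (fun e => by rw [e] at hj; exact absurd hv (not_le.2 hj))
        (fun e => by rw [e] at hj; exact absurd hv' (not_le.2 hj))
    · rw [Equiv.Perm.mul_apply, hπ.2, Equiv.swap_apply_left]
  · intro π hπ
    rw [mem_coe, mem_filter] at hπ ⊢
    refine ⟨mem_stabLT.2 fun j hj => ?_, ?_⟩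
    · rw [Equiv.Perm.mul_apply, mem_stabLT.1 hπ.1 j hj]
      exact Equiv.swap_apply_of_ne_of_ne (fun e => by rw [e] at hj; exact absurd hv (not_le.2 hj))
        (fun e => by rw [e] at hj; exact absurd hv' (not_le.2 hj))
    · rw [Equiv.Perm.mul_apply, hπ.2, Equiv.swap_apply_right]
  · intro π _
    show Equiv.swap v v' * (Equiv.swap v v' * π) = π
    rw [← mul_assoc, Equiv.swap_mul_self, one_mul]
  · intro π _
    show Equiv.swap v v' * (Equiv.swap v v' * π) = π
    rw [← mul_assoc, Equiv.swap_mul_self, one_mul]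

/-- `|Stab_{<k}| = (n − k) · |{π ∈ Stab_{<k} : π k = v}|` for each `v ≥ k`.
[cite: KeevashLifshitz2023, Lemma 2.3 (proof)] -/
theorem card_stabLT_eq_mul_fibre {k v : Fin n} (hv : k ≤ v) :
    ((stabLT n k).card : ℝ) = ((n : ℝ) - k) * ((stabLT n k).filter (fun π => π k = v)).card := by
  classical
  have hfib := card_eq_sum_card_fiberwise (s := stabLT n k) (t := univ.filter (fun w : Fin n => k ≤ w))
    (f := fun π => π k) (fun π hπ =>
      Finset.mem_coe.2 (mem_filter.2 ⟨mem_univ _, le_apply_of_mem_stabLT (Finset.mem_coe.1 hπ)⟩))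
  have hconst : ∀ w ∈ univ.filter (fun w : Fin n => k ≤ w),
      ((stabLT n k).filter (fun π => π k = w)).card = ((stabLT n k).filter (fun π => π k = v)).card :=
    fun w hw => card_stabLT_fibre_eq (mem_filter.1 hw).2 hv
  rw [sum_congr rfl hconst, sum_const, smul_eq_mul] at hfib
  have hIci : (univ.filter (fun w : Fin n => k ≤ w)).card = n - k := by
    rw [show (univ.filter (fun w : Fin n => k ≤ w)) = Finset.Ici k by ext w; simp, Fin.card_Ici]
  rw [hIci] at hfib
  rw [hfib]
  push_cast [Nat.cast_sub k.isLt.le]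
  ring

/-- **Symmetry of the stabiliser**: `Σ_{π ∈ Stab_{<k}} cw (σπ) k y = |Stab_{<k}|/n` for every `σ, y` —
in the forgetful model, given the conflict set `{σ 0,…,σ (k−1)}`, the next value of `x` is uniform
(the computation in the proof of KL Lemma 2.3: `P'(x_i = σ(i)) = (n−i+1)/n`, `P'(x_i = σ(j)) = 1/n`).
[cite: KeevashLifshitz2023, Lemma 2.3 (proof)] -/
theorem sum_stabLT_cw (σ : Equiv.Perm (Fin n)) (k y : Fin n) :
    ∑ π ∈ stabLT n k, cw (σ * π) k y = ((stabLT n k).card : ℝ) / n := by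
  classical
  have hn : (0 : ℝ) < n := by exact_mod_cast k.pos
  by_cases hy : ∃ j : Fin n, j < k ∧ σ j = y
  · -- Case A: `y` is an earlier value: weight `1/n` for every `π`
    obtain ⟨j, hj, hjy⟩ := hy
    have : ∀ π ∈ stabLT n k, cw (σ * π) k y = 1 / n := by
      intro π hπ
      rw [cw_mul_stab σ hπ, if_neg, if_pos ⟨j, hj, hjy⟩]
      intro e
      rw [← hjy] at e
      have := σ.injective e
      rw [this] at hj
      exact absurd (le_apply_of_mem_stabLT hπ) (not_le.2 hj)
    rw [sum_congr rfl this, sum_const, nsmul_eq_mul]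
    ring
  · -- Case B: `y` is a later value `σ v`, `v ≥ k`: weight `(n−k)/n` exactly when `π k = v`
    set v : Fin n := σ.symm y with hv
    have hyv : y = σ v := (Equiv.apply_symm_apply σ y).symm
    have hkv : k ≤ v := by
      by_contra hlt
      exact hy ⟨v, not_le.1 hlt, hyv.symm⟩
    have : ∀ π ∈ stabLT n k, cw (σ * π) k y = if π k = v then ((n : ℝ) - k) / n else 0 := by
      intro π hπ
      rw [cw_mul_stab σ hπ, if_neg hy, hyv]
      by_cases h : π k = v
      · rw [if_pos h, if_pos (by rw [h])]
      · rw [if_neg h, if_neg (fun e => h (σ.injective e).symm)]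
    rw [sum_congr rfl this, sum_ite, sum_const_zero, add_zero, sum_const, nsmul_eq_mul,
      card_stabLT_eq_mul_fibre hkv]
    ring

/-- **The next value is uniform** (prefix step of KL Lemma 2.3): if `F(σ)` depends only on
`σ 0, …, σ (k−1)` then `Σ_σ F(σ) · cw σ k y = (1/n) Σ_σ F(σ)` for every `y`.
[cite: KeevashLifshitz2023, Lemma 2.3 (proof)] -/
theorem sum_mul_cw_eq (F : Equiv.Perm (Fin n) → ℝ) (k y : Fin n)
    (hF : ∀ σ, ∀ π ∈ stabLT n k, F (σ * π) = F σ) :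
    ∑ σ, F σ * cw σ k y = (1 / n) * ∑ σ, F σ := by
  classical
  have hcard : (0 : ℝ) < ((stabLT n k).card : ℝ) := by
    exact_mod_cast card_pos.2 ⟨1, one_mem_stabLT k⟩
  -- average over the stabiliser (reindex `σ ↦ σπ`)
  have havg : ∑ π ∈ stabLT n k, ∑ σ, F (σ * π) * cw (σ * π) k y =
      ((stabLT n k).card : ℝ) * ∑ σ, F σ * cw σ k y := by
    rw [sum_congr rfl (fun π _ => Fintype.sum_equiv (Equiv.mulRight π)
      (fun σ => F (σ * π) * cw (σ * π) k y) (fun σ => F σ * cw σ k y) (fun σ => rfl)),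
      sum_const, nsmul_eq_mul]
  have hswap : ∑ π ∈ stabLT n k, ∑ σ, F (σ * π) * cw (σ * π) k y =
      ∑ σ, F σ * ∑ π ∈ stabLT n k, cw (σ * π) k y := by
    rw [sum_comm]
    refine sum_congr rfl fun σ _ => ?_
    rw [mul_sum]
    exact sum_congr rfl fun π hπ => by rw [hF σ π hπ]
  have hmain : ((stabLT n k).card : ℝ) * ∑ σ, F σ * cw σ k y =
      ((stabLT n k).card : ℝ) * ((1 / n) * ∑ σ, F σ) := by
    rw [← havg, hswap, mul_sum, mul_sum]
    exact sum_congr rfl fun σ _ => by rw [sum_stabLT_cw σ k y]; ring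
  exact mul_left_cancel₀ hcard.ne' hmain

/-- The prefix product `Π_{i<k} cw σ i (x i)` depends only on `σ 0, …, σ (k−1)`.
[cite: KeevashLifshitz2023, Def. 2.2] -/
theorem prod_prefix_mul_stab (x : Fin n → Fin n) (k : ℕ) (σ π : Equiv.Perm (Fin n)) (hπ : π ∈ stabLT n k) :
    ∏ i ∈ univ.filter (fun i : Fin n => (i : ℕ) < k), cw (σ * π) i (x i) =
      ∏ i ∈ univ.filter (fun i : Fin n => (i : ℕ) < k), cw σ i (x i) := by
  refine prod_congr rfl fun i hi => ?_
  rw [mem_filter] at hi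
  exact cw_mul_of_fix σ π (fun j hj => mem_stabLT.1 hπ j (lt_of_le_of_lt (by exact_mod_cast hj) hi.2)) _

/-- **Prefix induction** (KL Lemma 2.3): `Σ_σ Π_{i<k} cw σ i (x i) = n!/n^k` for every `x` and `k ≤ n`.
[cite: KeevashLifshitz2023, Lemma 2.3] -/
theorem sum_prod_prefix (x : Fin n → Fin n) : ∀ k : ℕ, k ≤ n →
    ∑ σ : Equiv.Perm (Fin n), ∏ i ∈ univ.filter (fun i : Fin n => (i : ℕ) < k), cw σ i (x i) =
      (n.factorial : ℝ) / (n : ℝ) ^ k := by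
  classical
  intro k
  induction k with
  | zero =>
    intro _
    have : univ.filter (fun i : Fin n => (i : ℕ) < 0) = ∅ := by ext i; simp
    rw [this]
    simp [Fintype.card_perm]
  | succ k ih =>
    intro hk
    have hkn : k < n := hk
    set κ : Fin n := ⟨k, hkn⟩ with hκ
    have hins : univ.filter (fun i : Fin n => (i : ℕ) < k + 1) =
        insert κ (univ.filter (fun i : Fin n => (i : ℕ) < k)) := by
      ext i
      simp only [mem_filter, mem_univ, true_and, mem_insert, Fin.ext_iff, hκ]
      omega
    have hnot : κ ∉ univ.filter (fun i : Fin n => (i : ℕ) < k) := by simp [hκ]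
    rw [hins]
    simp_rw [prod_insert hnot]
    rw [show (∑ σ : Equiv.Perm (Fin n), cw σ κ (x κ) * ∏ i ∈ univ.filter (fun i : Fin n => (i : ℕ) < k),
        cw σ i (x i)) = ∑ σ : Equiv.Perm (Fin n), (∏ i ∈ univ.filter (fun i : Fin n => (i : ℕ) < k),
        cw σ i (x i)) * cw σ κ (x κ) from sum_congr rfl fun σ _ => mul_comm _ _]
    rw [sum_mul_cw_eq _ κ (x κ) (fun σ π hπ => prod_prefix_mul_stab x k σ π hπ), ih hkn.le]
    have hn : (n : ℝ) ≠ 0 := by exact_mod_cast (Nat.pos_of_ne_zero (by omega) : 0 < n).ne'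
    rw [pow_succ]
    field_simp

/-- **The `x`-marginal is uniform** (KL Lemma 2.3): `Σ_σ C(σ, x) = 1/n^n` for every `x ∈ [n]^n`.
[cite: KeevashLifshitz2023, Lemma 2.3] -/
theorem sum_coupling_left (x : Fin n → Fin n) :
    ∑ σ : Equiv.Perm (Fin n), coupling σ x = (((n : ℝ) ^ n))⁻¹ := by
  classical
  unfold coupling
  rw [← mul_sum]
  have h := sum_prod_prefix x n le_rfl
  have huniv : univ.filter (fun i : Fin n => (i : ℕ) < n) = univ := by
    ext i; simp
  rw [huniv] at h
  rw [h]
  have hf : (n.factorial : ℝ) ≠ 0 := by positivity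
  field_simp

/-! ## Constrained product sums over `[n]^n` -/

/-- **Integrating out the free coordinates**: for weights `Φ i y` and prescribed values `b` at the
injective positions `ι`, `Σ_{x : x∘ι = b} Π_i Φ i (x i) = Π_k Φ (ι k) (b k) · Π_{i ∉ im ι} Σ_y Φ i y`.
[cite: KeevashLifshitz2023, §2.4 (eq. (fg): restriction of the coupling to the coordinates `I`)] -/
theorem sum_constrained_prod {d : ℕ} (ι : Fin d ↪ Fin n) (b : Fin d → Fin n) (Φ : Fin n → Fin n → ℝ) :
    ∑ x : Fin n → Fin n, (if ∀ k, x (ι k) = b k then ∏ i, Φ i (x i) else 0) =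
      (∏ k, Φ (ι k) (b k)) * ∏ i ∈ (univ.map ι)ᶜ, ∑ y, Φ i y := by
  classical
  -- weights with the constraint built in
  set Ψ : Fin n → Fin n → ℝ := fun i y => Φ i y * if (∀ k, ι k = i → y = b k) then 1 else 0 with hΨ
  have hprod : ∀ x : Fin n → Fin n, (if ∀ k, x (ι k) = b k then ∏ i, Φ i (x i) else 0) = ∏ i, Ψ i (x i) := by
    intro x
    simp only [hΨ]
    rw [prod_mul_distrib, prod_boole]
    have : (∀ i ∈ (univ : Finset (Fin n)), ∀ k, ι k = i → x i = b k) ↔ ∀ k, x (ι k) = b k := by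
      constructor
      · intro h k; exact h (ι k) (mem_univ _) k rfl
      · intro h i _ k hk; rw [← hk]; exact h k
    simp only [this]
    split_ifs <;> simp
  simp_rw [hprod]
  rw [← Fintype.piFinset_univ, ← prod_univ_sum, ← prod_mul_prod_compl (univ.map ι)]
  congr 1
  · rw [prod_map]
    refine prod_congr rfl fun k _ => ?_
    simp only [hΨ]
    rw [show (∑ y, Φ (ι k) y * if (∀ k', ι k' = ι k → y = b k') then (1 : ℝ) else 0) =
        ∑ y, if y = b k then Φ (ι k) y else 0 from sum_congr rfl fun y _ => ?_]
    · rw [sum_ite_eq']; simp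
    · have : (∀ k', ι k' = ι k → y = b k') ↔ y = b k := by
        constructor
        · intro h; exact h k rfl
        · intro h k' hk'; rw [ι.injective hk']; exact h
      simp only [this]
      split_ifs <;> simp
  · refine prod_congr rfl fun i hi => ?_
    rw [mem_compl, mem_map] at hi
    refine sum_congr rfl fun y _ => ?_
    simp only [hΨ]
    have : ∀ k, ι k = i → y = b k := fun k hk => (hi ⟨k, mem_univ _, hk⟩).elim
    rw [if_pos this, mul_one]

/-- With probability weights (`Σ_y Φ i y = 1`) the free coordinates integrate to `1`.
[cite: KeevashLifshitz2023, §2.4 (eq. (fg))] -/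
theorem sum_constrained_prod_of_sum_eq_one {d : ℕ} (ι : Fin d ↪ Fin n) (b : Fin d → Fin n)
    (Φ : Fin n → Fin n → ℝ) (hΦ : ∀ i, ∑ y, Φ i y = 1) :
    ∑ x : Fin n → Fin n, (if ∀ k, x (ι k) = b k then ∏ i, Φ i (x i) else 0) = ∏ k, Φ (ι k) (b k) := by
  rw [sum_constrained_prod, prod_eq_one (fun i _ => hΦ i), mul_one]

/-! ## The induced kernel on `d`-tuples (KL §2.4) -/

variable {d : ℕ}

/-- Restriction of a permutation to the positions `ι`: `k ↦ σ (ι k)`. [cite: KeevashLifshitz2023, §2.4 (`a = (σ(i) : i ∈ I)`)] -/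
def restrictPerm (ι : Fin d ↪ Fin n) (σ : Equiv.Perm (Fin n)) : Fin d ↪ Fin n := ι.trans σ.toEmbedding

/-- [cite: KeevashLifshitz2023, §2.4] -/
@[simp] theorem restrictPerm_apply (ι : Fin d ↪ Fin n) (σ : Equiv.Perm (Fin n)) (k : Fin d) :
    restrictPerm ι σ k = σ (ι k) := rfl

/-- [cite: KeevashLifshitz2023, §2.4] -/
theorem restrictPerm_mul (ι : Fin d ↪ Fin n) (τ σ : Equiv.Perm (Fin n)) :
    restrictPerm ι (τ * σ) = Tuple.lmap τ (restrictPerm ι σ) := by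
  ext k; simp [restrictPerm, Equiv.Perm.mul_apply]

/-- **The induced kernel** `ν(a,b) = C(σ∘ι = a, x∘ι = b)` on `[n]_d × [n]_d` (the free coordinates of
`x` integrated out): `ν(a,b) = (1/n!) Σ_{σ : σ∘ι = a} Π_k cw σ (ι k) (b k)`.
[cite: KeevashLifshitz2023, §2.4 (the coupling `ν(a,b)` on `[n]_d × [n]_d`)] -/
def indKernel (ι : Fin d ↪ Fin n) (a b : Fin d ↪ Fin n) : ℝ :=
  ((n.factorial : ℝ))⁻¹ * ∑ σ : Equiv.Perm (Fin n),
    if restrictPerm ι σ = a then ∏ k, cw σ (ι k) (b k) else 0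

/-- [cite: KeevashLifshitz2023, §2.4] -/
theorem indKernel_nonneg (ι : Fin d ↪ Fin n) (a b : Fin d ↪ Fin n) : 0 ≤ indKernel ι a b :=
  mul_nonneg (by positivity) (sum_nonneg fun σ _ => by
    split_ifs
    · exact prod_nonneg fun k _ => cw_nonneg _ _ _
    · exact le_rfl)

/-- **The induced kernel is left-invariant** (from Lemma 2.4). [cite: KeevashLifshitz2023, §2.4 ("`ν` is left `S_n`-invariant")] -/
theorem indKernel_leftInvariant (ι : Fin d ↪ Fin n) : Tuple.IsLeftInvariant (indKernel ι) := by
  classical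
  intro τ a b
  unfold indKernel
  congr 1
  -- reindex `σ ↦ τ * σ`
  rw [← Equiv.sum_comp (Equiv.mulLeft τ)]
  refine sum_congr rfl fun σ _ => ?_
  simp only [Equiv.coe_mulLeft, restrictPerm_mul, EmbeddingLike.apply_eq_iff_eq]
  split_ifs
  · refine prod_congr rfl fun k _ => ?_
    rw [Tuple.lmap_apply, cw_lmul]
  · rfl

/-- **The induced kernel is pointwise `2/n`-spread** when all positions are `≤ n/2`: moving a coordinate
replaces a lazy weight `≥ 1/2` by a weight `≤ 1/n`. (KL: "clearly `ν` is `10/n`-spread".)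
[cite: KeevashLifshitz2023, §2.4 (after Def. 2.10)] -/
theorem indKernel_spread (ι : Fin d ↪ Fin n) (hι : ∀ k, 2 * ((ι k : Fin n) : ℕ) ≤ n) :
    Tuple.IsSpread (indKernel ι) (2 / n) := by
  classical
  intro a b
  unfold indKernel
  rw [mul_assoc, sum_mul]
  refine mul_le_mul_of_nonneg_left (sum_le_sum fun σ _ => ?_) (by positivity)
  split_ifs with h
  · -- termwise comparison, `a k = σ (ι k)`
    have ha : ∀ k, a k = σ (ι k) := fun k => by rw [← h]; rfl
    calc ∏ k, cw σ (ι k) (b k)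
        ≤ ∏ k, (if a k ≠ b k then (2 : ℝ) / n else 1) * cw σ (ι k) (a k) := by
          refine prod_le_prod (fun k _ => cw_nonneg _ _ _) fun k _ => ?_
          split_ifs with hk
          · rw [ha k]
            have h1 := cw_le_of_ne (σ := σ) (i := ι k) (y := b k) (by rw [← ha k]; exact Ne.symm hk)
            have h2 := half_le_cw_self σ (hι k)
            calc cw σ (ι k) (b k) ≤ 1 / n := h1
              _ = 2 / n * (1 / 2) := by ring
              _ ≤ 2 / n * cw σ (ι k) (σ (ι k)) := by gcongr
          · rw [not_not] at hk; rw [hk, one_mul]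
      _ = (∏ k, cw σ (ι k) (a k)) * (2 / n) ^ Tuple.moved a b := by
          rw [prod_mul_distrib, prod_ite, prod_const_one, mul_one, prod_const, mul_comm]
          rfl
  · simp

/-- **Diagonal mass** (eq. (lazy)): `Σ_a ν(a,a) = Π_k (n − ι k)/n`. [cite: KeevashLifshitz2023, §2.4 (eq. (lazy))] -/
theorem sum_indKernel_diag (ι : Fin d ↪ Fin n) :
    ∑ a : Fin d ↪ Fin n, indKernel ι a a = ∏ k, (((n : ℝ) - (ι k : Fin n)) / n) := by
  classical
  unfold indKernel
  rw [← mul_sum, sum_comm]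
  have : ∀ σ : Equiv.Perm (Fin n), (∑ a : Fin d ↪ Fin n,
      if restrictPerm ι σ = a then ∏ k, cw σ (ι k) (a k) else 0) = ∏ k, (((n : ℝ) - (ι k : Fin n)) / n) := by
    intro σ
    rw [sum_ite_eq]
    simp only [mem_univ, if_true, restrictPerm_apply, cw_self]
  rw [sum_congr rfl (fun σ _ => this σ), sum_const, card_univ, Fintype.card_perm, Fintype.card_fin,
    nsmul_eq_mul, ← mul_assoc, inv_mul_cancel₀ (by positivity), one_mul]

/-- `Σ_a ν(a,a) ≥ 2^{−d}` when all positions are `≤ n/2` (eq. (lazy): `P(E) p_lazy ≥ 2^{−d}`).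
[cite: KeevashLifshitz2023, §2.4 (eq. (lazy))] -/
theorem sum_indKernel_diag_ge (ι : Fin d ↪ Fin n) (hι : ∀ k, 2 * ((ι k : Fin n) : ℕ) ≤ n) :
    (1 / 2 : ℝ) ^ d ≤ ∑ a : Fin d ↪ Fin n, indKernel ι a a := by
  rw [sum_indKernel_diag]
  calc (1 / 2 : ℝ) ^ d = ∏ _k : Fin d, (1 / 2 : ℝ) := by simp
    _ ≤ ∏ k, (((n : ℝ) - (ι k : Fin n)) / n) :=
        prod_le_prod (fun _ _ => by norm_num) fun k _ => by
          have := half_le_cw_self (1 : Equiv.Perm (Fin n)) (hι k)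
          rwa [cw_self] at this

/-- The diagonal value at one point: `ν(a₀,a₀) · |[n]_d| ≥ 2^{−d}` (the diagonal is constant by left
invariance). [cite: KeevashLifshitz2023, §2.4 (`p_lazy = |[n]_d| ν(a,a)`)] -/
theorem indKernel_diag_mul_card_ge (ι : Fin d ↪ Fin n) (hι : ∀ k, 2 * ((ι k : Fin n) : ℕ) ≤ n)
    (a₀ : Fin d ↪ Fin n) :
    (1 / 2 : ℝ) ^ d ≤ indKernel ι a₀ a₀ * (Fintype.card (Fin d ↪ Fin n) : ℝ) := by
  have h := sum_indKernel_diag_ge ι hι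
  rw [sum_congr rfl (fun a _ => Tuple.kernel_diag_eq (indKernel_leftInvariant ι) a a₀), sum_const,
    card_univ, nsmul_eq_mul] at h
  linarith

/-! ## Juntas and eq. (fg) -/

/-- The `S_n`-function `f(σ) = g(σ∘ι)` lifted from a function `g` on `d`-tuples (an `im ι`-junta).
[cite: KeevashLifshitz2023, §2.4 ("`g ∈ L²([n]_d)` naturally defined by `g(J) = f(σ)` for `σ ∈ U_{I→J}`")] -/
def liftFun (ι : Fin d ↪ Fin n) (g : (Fin d ↪ Fin n) → ℝ) : Equiv.Perm (Fin n) → ℝ :=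
  fun σ => g (restrictPerm ι σ)

/-- The ASSOCIATED `[n]^n`-junta `f̃(x) = g(x∘ι)` if the coordinates of `x` at `ι` are distinct, else `0`.
[cite: KeevashLifshitz2023, §2.3 (before Lemma 2.9: "the associated `T`-junta `f̃` on `[n]^n`")] -/
def liftFunX (ι : Fin d ↪ Fin n) (g : (Fin d ↪ Fin n) → ℝ) : (Fin n → Fin n) → ℝ :=
  fun x => if h : Function.Injective (fun k => x (ι k)) then g ⟨fun k => x (ι k), h⟩ else 0

/-- Summing a function of the (injective) restriction `x∘ι` over the dichotomy injective/non-injective: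
`Σ_{b : Fin d → Fin n} [b injective] G ⟨b⟩ · Φ b = Σ_{e : Fin d ↪ Fin n} G e · Φ e`. [folklore] -/
private theorem sum_dite_injective (G : (Fin d ↪ Fin n) → ℝ) (Φ : (Fin d → Fin n) → ℝ) :
    ∑ b : Fin d → Fin n, (if h : Function.Injective b then G ⟨b, h⟩ else 0) * Φ b =
      ∑ e : Fin d ↪ Fin n, G e * Φ e := by
  classical
  symm
  rw [show (∑ e : Fin d ↪ Fin n, G e * Φ e) =
      ∑ e : Fin d ↪ Fin n, (fun b : Fin d → Fin n =>
        (if h : Function.Injective b then G ⟨b, h⟩ else 0) * Φ b) (⇑e) from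
    sum_congr rfl fun e _ => by
      show G e * Φ e = (if h : Function.Injective (⇑e) then G ⟨⇑e, h⟩ else 0) * Φ e
      rw [dif_pos e.injective]
      congr 2]
  rw [← sum_image (f := fun b : Fin d → Fin n => (if h : Function.Injective b then G ⟨b, h⟩ else 0) * Φ b)
    (s := (univ : Finset (Fin d ↪ Fin n))) (g := fun e => (⇑e : Fin d → Fin n))
    (fun e₁ _ e₂ _ h => DFunLike.coe_injective h)]
  refine sum_subset (subset_univ _) fun b _ hb => ?_
  have : ¬ Function.Injective b := by
    intro h
    exact hb (mem_image.2 ⟨⟨b, h⟩, mem_univ _, rfl⟩)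
  simp [this]

/-- **Eq. (fg)**: `Σ_{σ,x} C(σ,x) f(σ) f̃(x) = Σ_{a,b} ν(a,b) g(a) g(b)` for `f = g(σ∘ι)` and its associated
`[n]^n`-junta `f̃`. [cite: KeevashLifshitz2023, §2.4 (eq. (fg))] -/
theorem sum_coupling_lift_eq (ι : Fin d ↪ Fin n) (g : (Fin d ↪ Fin n) → ℝ) :
    ∑ σ : Equiv.Perm (Fin n), ∑ x : Fin n → Fin n, coupling σ x * (liftFun ι g σ * liftFunX ι g x) =
      ∑ a : Fin d ↪ Fin n, ∑ b : Fin d ↪ Fin n, indKernel ι a b * (g a * g b) := by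
  classical
  -- Step 1: integrate out the free coordinates of `x`, for each `σ`
  have hx : ∀ σ : Equiv.Perm (Fin n), ∑ x : Fin n → Fin n, coupling σ x * (liftFun ι g σ * liftFunX ι g x) =
      liftFun ι g σ * ((n.factorial : ℝ))⁻¹ *
        ∑ b : Fin d ↪ Fin n, g b * ∏ k, cw σ (ι k) (b k) := by
    intro σ
    -- group `x` by `b = x ∘ ι`
    have hfib : ∑ x : Fin n → Fin n, coupling σ x * (liftFun ι g σ * liftFunX ι g x) =
        ∑ b : Fin d → Fin n, ∑ x : Fin n → Fin n,
          if (fun k => x (ι k)) = b then coupling σ x * (liftFun ι g σ * liftFunX ι g x) else 0 := by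
      rw [sum_comm]
      refine sum_congr rfl fun x _ => ?_
      rw [sum_ite_eq]; simp
    rw [hfib]
    have hinner : ∀ b : Fin d → Fin n, (∑ x : Fin n → Fin n,
        if (fun k => x (ι k)) = b then coupling σ x * (liftFun ι g σ * liftFunX ι g x) else 0) =
        liftFun ι g σ * ((n.factorial : ℝ))⁻¹ *
          ((if h : Function.Injective b then g ⟨b, h⟩ else 0) * ∏ k, cw σ (ι k) (b k)) := by
      intro b
      have hval : ∀ x : Fin n → Fin n, (fun k => x (ι k)) = b →
          liftFunX ι g x = if h : Function.Injective b then g ⟨b, h⟩ else 0 := by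
        intro x hxb
        unfold liftFunX
        subst hxb
        rfl
      rw [show (∑ x : Fin n → Fin n,
          if (fun k => x (ι k)) = b then coupling σ x * (liftFun ι g σ * liftFunX ι g x) else 0) =
          ∑ x : Fin n → Fin n, (liftFun ι g σ * ((n.factorial : ℝ))⁻¹ *
            (if h : Function.Injective b then g ⟨b, h⟩ else 0)) *
            (if ∀ k, x (ι k) = b k then ∏ i, cw σ i (x i) else 0) from sum_congr rfl fun x _ => by
          by_cases hxb : (fun k => x (ι k)) = b
          · rw [if_pos hxb, if_pos (fun k => congr_fun hxb k), hval x hxb, coupling]; ring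
          · rw [if_neg hxb, if_neg (fun h => hxb (funext h)), mul_zero]]
      rw [← mul_sum, sum_constrained_prod_of_sum_eq_one ι b (fun i y => cw σ i y) (sum_cw σ)]
      ring
    rw [sum_congr rfl (fun b _ => hinner b), ← mul_sum, sum_dite_injective]
  simp_rw [hx]
  -- Step 2: group `σ` by `a = σ ∘ ι`
  have hσ : ∀ b : Fin d ↪ Fin n, ∑ σ : Equiv.Perm (Fin n), liftFun ι g σ * ((n.factorial : ℝ))⁻¹ *
      (g b * ∏ k, cw σ (ι k) (b k)) = ∑ a : Fin d ↪ Fin n, indKernel ι a b * (g a * g b) := by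
    intro b
    have : ∀ σ : Equiv.Perm (Fin n), liftFun ι g σ * ((n.factorial : ℝ))⁻¹ * (g b * ∏ k, cw σ (ι k) (b k)) =
        ∑ a : Fin d ↪ Fin n, if restrictPerm ι σ = a then
          g a * ((n.factorial : ℝ))⁻¹ * (g b * ∏ k, cw σ (ι k) (b k)) else 0 := by
      intro σ
      rw [sum_ite_eq]
      simp [liftFun]
    rw [sum_congr rfl (fun σ _ => this σ), sum_comm]
    refine sum_congr rfl fun a _ => ?_
    unfold indKernel
    rw [mul_sum, sum_mul]
    refine sum_congr rfl fun σ _ => ?_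
    split_ifs <;> ring
  rw [show (∑ σ : Equiv.Perm (Fin n), liftFun ι g σ * ((n.factorial : ℝ))⁻¹ *
      ∑ b : Fin d ↪ Fin n, g b * ∏ k, cw σ (ι k) (b k)) =
      ∑ b : Fin d ↪ Fin n, ∑ σ : Equiv.Perm (Fin n), liftFun ι g σ * ((n.factorial : ℝ))⁻¹ *
        (g b * ∏ k, cw σ (ι k) (b k)) by
    rw [sum_comm]
    exact sum_congr rfl fun σ _ => by rw [mul_sum]]
  rw [sum_congr rfl (fun b _ => hσ b), sum_comm]

/-! ## Lemma 2.9 (counting form) -/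

/-- The fibres `{σ : σ∘ι = a}` all have the same size, `n!/|[n]_d|`.
[cite: KeevashLifshitz2023, §2.4 ("`‖f‖₂ = ‖g‖₂`")] -/
theorem card_fibre_mul_card (ι : Fin d ↪ Fin n) (a : Fin d ↪ Fin n) :
    (((univ : Finset (Equiv.Perm (Fin n))).filter (fun σ => restrictPerm ι σ = a)).card : ℝ) *
      (Fintype.card (Fin d ↪ Fin n) : ℝ) = n.factorial := by
  classical
  -- all fibres have the same size (left translation)
  have hconst : ∀ a' : Fin d ↪ Fin n,
      ((univ : Finset (Equiv.Perm (Fin n))).filter (fun σ => restrictPerm ι σ = a')).card =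
      ((univ : Finset (Equiv.Perm (Fin n))).filter (fun σ => restrictPerm ι σ = a)).card := by
    intro a'
    obtain ⟨τ, hτ⟩ := Tuple.exists_perm_lmap_eq a a'
    symm
    refine card_nbij' (fun σ => τ * σ) (fun σ => τ⁻¹ * σ) ?_ ?_ (fun σ _ => by simp) (fun σ _ => by simp)
    · intro σ hσ
      rw [mem_coe, mem_filter] at hσ ⊢
      refine ⟨mem_univ _, ?_⟩
      rw [restrictPerm_mul, hσ.2, hτ]
    · intro σ hσ
      rw [mem_coe, mem_filter] at hσ ⊢
      refine ⟨mem_univ _, ?_⟩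
      rw [restrictPerm_mul, hσ.2, ← hτ]
      ext k; simp
  have htot := card_eq_sum_card_fiberwise (s := (univ : Finset (Equiv.Perm (Fin n))))
    (t := (univ : Finset (Fin d ↪ Fin n))) (f := fun σ => restrictPerm ι σ) (fun _ _ => mem_univ _)
  rw [card_univ, Fintype.card_perm, Fintype.card_fin, sum_congr rfl (fun a' _ => hconst a'), sum_const,
    card_univ, smul_eq_mul] at htot
  rw [mul_comm]
  exact_mod_cast htot.symm

/-- `Σ_σ f(σ)² = |fibre| · Σ_a g(a)²` for the lifted junta. [cite: KeevashLifshitz2023, §2.4 ("`‖f‖₂ = ‖g‖₂`")] -/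
theorem sum_liftFun_sq (ι : Fin d ↪ Fin n) (g : (Fin d ↪ Fin n) → ℝ) (a₀ : Fin d ↪ Fin n) :
    ∑ σ : Equiv.Perm (Fin n), liftFun ι g σ ^ 2 =
      (((univ : Finset (Equiv.Perm (Fin n))).filter (fun σ => restrictPerm ι σ = a₀)).card : ℝ) *
        ∑ a : Fin d ↪ Fin n, g a ^ 2 := by
  classical
  rw [← sum_fiberwise (s := (univ : Finset (Equiv.Perm (Fin n)))) (g := fun σ => restrictPerm ι σ)
    (f := fun σ => liftFun ι g σ ^ 2), mul_sum]
  refine sum_congr rfl fun a _ => ?_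
  rw [show (∑ σ ∈ (univ : Finset (Equiv.Perm (Fin n))) with restrictPerm ι σ = a, liftFun ι g σ ^ 2) =
      ∑ σ ∈ (univ : Finset (Equiv.Perm (Fin n))) with restrictPerm ι σ = a, g a ^ 2 from
    sum_congr rfl fun σ hσ => by rw [mem_filter] at hσ; rw [liftFun, hσ.2], sum_const, nsmul_eq_mul]
  congr 1
  have h1 := card_fibre_mul_card ι a
  have h2 := card_fibre_mul_card ι a₀
  have hN : (0 : ℝ) < (Fintype.card (Fin d ↪ Fin n) : ℝ) := by
    exact_mod_cast Fintype.card_pos_iff.2 ⟨a₀⟩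
  exact mul_right_cancel₀ hN.ne' (h1.trans h2.symm)

/-- **KL Lemma 2.9 (counting form).** For `g` of pure top degree on `[n]_d`, positions `ι` with
`2·ι k ≤ n`, and `16 d ≤ n`: `Σ_{σ,x} C(σ,x) f(σ) f̃(x) ≥ 2^{−(d+1)} · Σ_σ f(σ)² / n!` where
`f(σ) = g(σ∘ι)` and `f̃` is its associated `[n]^n`-junta — i.e. `⟨T_C f, f̃⟩ ≥ 2^{−(d+1)} ‖f‖₂²`
(print: `3^{−d}`). [cite: KeevashLifshitz2023, Lemma 2.9] -/
theorem junta_coupling_lower_bound (ι : Fin d ↪ Fin n) (hι : ∀ k, 2 * ((ι k : Fin n) : ℕ) ≤ n)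
    (hn : 16 * d ≤ n) {g : (Fin d ↪ Fin n) → ℝ} (hg : Tuple.IsPureTop g) :
    (1 / 2 : ℝ) ^ (d + 1) * (∑ σ : Equiv.Perm (Fin n), liftFun ι g σ ^ 2) / n.factorial ≤
      ∑ σ : Equiv.Perm (Fin n), ∑ x : Fin n → Fin n, coupling σ x * (liftFun ι g σ * liftFunX ι g x) := by
  classical
  rw [sum_coupling_lift_eq]
  have hν := indKernel_leftInvariant ι
  have h0 := indKernel_nonneg ι
  have hsp := indKernel_spread ι hι
  have hp : (0 : ℝ) ≤ 2 / n := by positivity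
  have hq := Tuple.quadratic_form_ge hν h0 hsp hp hg ι
  -- the error constant is at most `8d/n ≤ 1/2`
  have hε : Tuple.patExtSum d (2 / (n : ℝ)) ≤ 1 / 2 := by
    rcases Nat.eq_zero_or_pos n with h0n | h0n
    · subst h0n
      have hd : d = 0 := by omega
      subst hd
      -- `d = 0`: only the identity pattern exists
      unfold Tuple.patExtSum
      rw [sum_eq_zero]
      · norm_num
      · intro π hπ
        exfalso
        rw [mem_erase] at hπ
        exact hπ.1 (funext fun i => Fin.elim0 i)
    have hn' : (0 : ℝ) < n := by exact_mod_cast h0n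
    have h16 : (16 : ℝ) * d ≤ n := by exact_mod_cast hn
    have hsmall : 2 * (2 / (n : ℝ)) * d ≤ 1 / 2 := by
      rw [show 2 * (2 / (n : ℝ)) * d = 4 * d / n by ring, div_le_iff₀ hn']
      linarith
    refine (Tuple.patExtSum_le_of_le hp hsmall).trans ?_
    rw [show 4 * (2 / (n : ℝ)) * d = 8 * d / n by ring, div_le_iff₀ hn']
    linarith
  have hG : 0 ≤ ∑ a : Fin d ↪ Fin n, g a ^ 2 := sum_nonneg fun _ _ => sq_nonneg _
  have hdiag := indKernel_diag_mul_card_ge ι hι ι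
  have hN : (0 : ℝ) < (Fintype.card (Fin d ↪ Fin n) : ℝ) := by exact_mod_cast Fintype.card_pos_iff.2 ⟨ι⟩
  have hfac : (0 : ℝ) < n.factorial := by exact_mod_cast n.factorial_pos
  -- `Σ_σ f² = M · Σ_a g²` with `M · N = n!`
  rw [sum_liftFun_sq ι g ι]
  set M : ℝ := (((univ : Finset (Equiv.Perm (Fin n))).filter (fun σ => restrictPerm ι σ = ι)).card : ℝ)
    with hM
  have hMN : M * (Fintype.card (Fin d ↪ Fin n) : ℝ) = n.factorial := card_fibre_mul_card ι ι
  have hM0 : M ≠ 0 := by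
    rw [hM]
    have : (1 : Equiv.Perm (Fin n)) ∈ (univ : Finset (Equiv.Perm (Fin n))).filter
        (fun σ => restrictPerm ι σ = ι) := by
      rw [mem_filter]; exact ⟨mem_univ _, by ext k; simp⟩
    exact_mod_cast (card_pos.2 ⟨1, this⟩).ne'
  set N : ℝ := (Fintype.card (Fin d ↪ Fin n) : ℝ) with hNdef
  -- chain
  calc (1 / 2 : ℝ) ^ (d + 1) * (M * ∑ a : Fin d ↪ Fin n, g a ^ 2) / n.factorial
      = (1 / 2) * ((1 / 2) ^ d / N) * ∑ a : Fin d ↪ Fin n, g a ^ 2 := by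
        rw [← hMN]; field_simp; ring
    _ ≤ (1 - Tuple.patExtSum d (2 / (n : ℝ))) * indKernel ι ι ι * ∑ a : Fin d ↪ Fin n, g a ^ 2 := by
        apply mul_le_mul_of_nonneg_right _ hG
        have h1 : (1 / 2 : ℝ) ≤ 1 - Tuple.patExtSum d (2 / (n : ℝ)) := by linarith
        have h2 : (1 / 2 : ℝ) ^ d / N ≤ indKernel ι ι ι := by
          rw [div_le_iff₀ hN]; exact hdiag
        exact mul_le_mul h1 h2 (by positivity) (by linarith)
    _ ≤ _ := hq

end Coupling

end Literature.Combinatorics.Additive.KeevashLifshitz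

end
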